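import Summits.BirchSwinnertonDyer.BirchSwinnertonDyer.Theorems.Rank1ResidualJetCarrierRowData
import Literature.NumberTheory.EllipticCurves.PAdicBSDSplitMultiplicativeProofs
import Literature.NumberTheory.EllipticCurves.NeronComponentIndexSplitProofs
import Summits.BirchSwinnertonDyer.Rank1Residual.X11b.BDPRouteTamagawaSupport
import HarnessLib

/-!
# ErratumRoadFive, crux `EulerHalfNotRamNoInertSetAtFive` (stmt-BirchSwinnertonDyer-19715), ideator line
# `aux_norm_receptacle`, stub S1 — step F2 (part 2): the local data at a K-SPLIT carrier `q`
# (minimality of `W ⊗ K_v`, split multiplicative reduction at `v`, and `ord_v Δ_min(W ⊗ K) = ord_q Δ_min(W)`)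

Cell `bsd-stepL`, width seat `bsd-line-er5-p1-w3` g6. THEOREMS ONLY (no definition, no named fact, no `sorry`);
`--supports stmt-BirchSwinnertonDyer-19715`. HONEST FRAMING: kernel plumbing for the ideator's stub S1
(`TateComponentFamily[Linear]`, hypotheses `IsImaginaryQuadratic K`, `W.HasSplitMultiplicativeReductionAtPrime q`,
`#primesOver (q) (𝓞 K) = 2`); nothing closes 19715; item 27982 untouched; no summit statement is proved; BSD is
proved for no curve.

## What

For `W/ℚ` globally minimal, `K` imaginary quadratic, a rational prime `q` with two primes of `𝓞 K` above it and
split multiplicative reduction of `W` at `q`, and a place `v ∋ q` of `K`: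

* `exists_ne_of_ncard_primesOver_eq_two` — the OTHER place `w ≠ v` above `q`.
* `splitPlace_localData` — (a) `(W ⊗ K) ⊗ K_v` is a minimal `𝓞_v`-equation; (b) `W ⊗ K` has split
  multiplicative reduction at `v` (`HasSplitMultiplicativeReductionAt`); (c)
  `ord_v Δ_min(W ⊗ K) = (W ⊗ K).ordMinimalDiscriminant v = padicValInt q Δ_min(W)` — the exponent of the local
  Tate component character of `TateComponent.exists_componentHom_localPoints` IS the `ord_q Δ_min` of S1's
  `ZMod`. Mechanism: `e(v|q) = f(v|q) = 1` (`LocalField.ramificationIdx_eq_one_and_inertiaDeg_eq_one_of_ne`),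
  so `ℚ_{(q)} ≃ K_v` compatibly with the integers (`exists_ringEquiv_adicCompletion_of_…`), along which
  minimality, split multiplicative reduction (`hasSplitMultiplicativeReduction_map_ringEquiv_iff`, Silverman VII.5.1
  (b) with VII.1.3 (b)) and Tamagawa numbers (`carrierRowData_of_split`) are transported; then
  `c_v = ord_v Δ_min` at a split place (`localTamagawaNumber_eq_ordMinimalDiscriminant_…`, ATAEC IV.9.2 (d)) and
  `c_q = ord_q Δ_min` (`localTamagawaNumber_eq_padicValInt_of_split`).

References (locators only): [cite: SilvermanAEC2009, VII.1 Prop. 1.3 (b), VII.5 Prop. 5.1 (b), VII.6 Ex. 7.6]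
[cite: SilvermanATAEC1994, Cor. IV.9.2 (d)] [cite: CasselsFrohlichANT1967, Ch. II §10].
-/

set_option linter.dupNamespace false

noncomputable section

open scoped Classical
open NumberField IsDedekindDomain Field WeierstrassCurve Ideal

namespace Summit.BirchSwinnertonDyer.BirchSwinnertonDyer.Theorems.TateComponent

open Literature.NumberTheory.EllipticCurves Literature.NumberTheory.GaloisRepresentations
  IsDedekindDomain.HeightOneSpectrum Summit.BirchSwinnertonDyer.Rank1Residual.X11b
  Summit.BirchSwinnertonDyer.Rank1Residual.JET Rat.HeightOneSpectrum Literature.NumberTheory.Automorphic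

variable {K : Type} [Field K] [NumberField K]

/-- **The other prime above a split rational prime.** If the rational prime `q` has exactly two primes of `𝓞 K`
above it and `v ∋ q`, there is a place `w ≠ v` of `K` with `q ∈ w`. [cite: Marcus2018, Ch. 3 Thm. 21] -/
theorem exists_ne_of_ncard_primesOver_eq_two {q : ℕ} (hq : q.Prime)
    (hq2 : ((Ideal.span {(q : ℤ)}).primesOver (𝓞 K)).ncard = 2) (v : HeightOneSpectrum (𝓞 K))
    (hqv : ((q : ℕ) : 𝓞 K) ∈ v.asIdeal) :
    ∃ w : HeightOneSpectrum (𝓞 K), w ≠ v ∧ ((q : ℕ) : 𝓞 K) ∈ w.asIdeal := by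
  have hq0 : (q : ℤ) ≠ 0 := by exact_mod_cast hq.ne_zero
  haveI hmax : (span {(q : ℤ)}).IsMaximal :=
    ((span_singleton_prime hq0).mpr (Nat.prime_iff_prime_int.mp hq)).isMaximal
      (by rw [ne_eq, span_singleton_eq_bot]; exact hq0)
  -- `v` lies over `(q)`
  have hvS : v.asIdeal ∈ (span {(q : ℤ)}).primesOver (𝓞 K) := by
    refine ⟨v.isPrime, ⟨hmax.eq_of_le (comap_ne_top _ v.isPrime.ne_top) ?_⟩⟩
    rw [span_singleton_le_iff_mem, mem_comap, map_natCast]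
    exact hqv
  obtain ⟨x, y, hxy, hS⟩ := Set.ncard_eq_two.mp hq2
  -- the other element of the two-element set
  obtain ⟨P', hP'S, hP'v⟩ : ∃ P' ∈ (span {(q : ℤ)}).primesOver (𝓞 K), P' ≠ v.asIdeal := by
    rw [hS] at hvS ⊢
    rcases hvS with h | h
    · exact ⟨y, by simp, fun e ↦ hxy (h.symm.trans e.symm)⟩
    · simp only [Set.mem_singleton_iff] at h
      exact ⟨x, by simp, fun e ↦ hxy (e.trans h)⟩
  obtain ⟨hP'p, hP'l⟩ := hP'S
  have hne : P' ≠ ⊥ := by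
    haveI := hP'p
    haveI := hP'l
    exact ne_bot_of_liesOver_of_ne_bot (p := span {(q : ℤ)})
      (by rw [ne_eq, span_singleton_eq_bot]; exact hq0) P'
  refine ⟨⟨P', hP'p, hne⟩, fun h ↦ hP'v (congrArg HeightOneSpectrum.asIdeal h), ?_⟩
  have h1 : (q : ℤ) ∈ P'.under ℤ := by
    rw [← hP'l.over]; exact mem_span_singleton_self _
  rw [under_def, mem_comap, map_natCast] at h1
  exact h1

set_option maxHeartbeats 800000 in
/-- **Local data at a K-split carrier.** `W/ℚ` globally minimal and elliptic, `K` imaginary quadratic, `q` a rational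
prime with `#primesOver (q) (𝓞 K) = 2` at which `W` has split multiplicative reduction, `v ∋ q` a place of `K`:
(a) `(W ⊗ K) ⊗ K_v` is a minimal `𝓞_v`-equation; (b) `W ⊗ K` has split multiplicative reduction at `v`;
(c) `(W ⊗ K).ordMinimalDiscriminant v = padicValInt q W.minimalDiscriminantInt` (`= c_q = c_v`).
(`K_v ≅ ℚ_q` as `e = f = 1`; Silverman VII.1.3 (b), VII.5.1 (b); ATAEC IV.9.2 (d).)
[cite: SilvermanAEC2009, VII.1 Prop. 1.3 (b), VII.5 Prop. 5.1 (b)] [cite: SilvermanATAEC1994, Cor. IV.9.2 (d)]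
[cite: CasselsFrohlichANT1967, Ch. II §10] -/
theorem splitPlace_localData (W : WeierstrassCurve ℚ) [W.IsElliptic] [W.IsGloballyMinimal]
    (hK : IsImaginaryQuadratic K) {q : ℕ} [Fact q.Prime]
    (hq2 : ((Ideal.span {(q : ℤ)}).primesOver (𝓞 K)).ncard = 2)
    (hs : W.HasSplitMultiplicativeReductionAtPrime q) (v : HeightOneSpectrum (𝓞 K))
    (hqv : ((q : ℕ) : 𝓞 K) ∈ v.asIdeal) :
    ((W.baseChange K).baseChange (v.adicCompletion K)).IsMinimal (v.adicCompletionIntegers K) ∧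
      (W.baseChange K).HasSplitMultiplicativeReductionAt v ∧
      (W.baseChange K).ordMinimalDiscriminant v = padicValInt q W.minimalDiscriminantInt := by
  have hq : q.Prime := Fact.out
  haveI : Algebra.IsQuadraticExtension ℚ K := ⟨hK.1⟩
  haveI : (W.baseChange K).IsElliptic := inferInstanceAs (W.map (algebraMap ℚ K)).IsElliptic
  -- the other place above `q`, and `e(v|q) = f(v|q) = 1`
  obtain ⟨w, hwv, hqw⟩ := exists_ne_of_ncard_primesOver_eq_two hq hq2 v hqv
  obtain ⟨⟨he, hf⟩, -⟩ := LocalField.ramificationIdx_eq_one_and_inertiaDeg_eq_one_of_ne q v w hwv.symm hqv hqw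
  -- the place of `ℚ` below `v`
  set vp : HeightOneSpectrum (𝓞 ℚ) := v.under (𝓞 ℚ) with hvpdef
  haveI : v.asIdeal.LiesOver vp.asIdeal := ⟨rfl⟩
  have hqvp : ((q : ℕ) : 𝓞 ℚ) ∈ vp.asIdeal := LocalField.natCast_mem_under q v hqv
  have hqq : ((primesEquiv vp : Nat.Primes) : ℕ) = q := LocalField.primesEquiv_eq_of_natCast_mem q vp hqvp
  -- `ℚ_{(q)} ≃ K_v` compatibly with the valuation rings
  obtain ⟨ψ, φ, hc, hφ⟩ :=
    exists_ringEquiv_adicCompletion_of_ramificationIdx_eq_one_of_inertiaDeg_eq_one ℚ K vp v he hf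
  have hrange := ringEquiv_mem_range_algebraMap_iff ψ φ hc
  set X := W.baseChange (vp.adicCompletion ℚ) with hXdef
  have hX : X.map (φ : vp.adicCompletion ℚ →+* v.adicCompletion K) =
      (W.baseChange K).baseChange (v.adicCompletion K) := by
    rw [hXdef, WeierstrassCurve.baseChange, WeierstrassCurve.baseChange, WeierstrassCurve.baseChange,
      WeierstrassCurve.map_map, WeierstrassCurve.map_map]
    congr 1
    refine RingHom.ext fun x ↦ ?_
    rw [RingHom.comp_apply, RingHom.comp_apply, RingEquiv.coe_toRingHom]
    exact hφ x
  haveI : X.IsElliptic := by rw [hXdef, WeierstrassCurve.baseChange]; infer_instance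
  -- (b) split multiplicative reduction, transported from `ℚ_{(q)}`
  have hsQ : W.HasSplitMultiplicativeReductionAt vp := by
    have key : ∀ (p₁ p₂ : ℕ) (i₁ : Fact p₁.Prime) (i₂ : Fact p₂.Prime), p₁ = p₂ →
        (@HasSplitMultiplicativeReductionAtPrime W p₁ i₁ ↔ @HasSplitMultiplicativeReductionAtPrime W p₂ i₂) := by
      rintro p₁ p₂ i₁ i₂ rfl; rfl
    exact (hasSplitMultiplicativeReductionAtPrime_iff_hasSplitMultiplicativeReductionAt W vp).mp
      ((key q (primesEquiv vp) inferInstance (Fact.mk (primesEquiv vp).2) hqq.symm).mp hs)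
  have hsQ' : (X.minimal (vp.adicCompletionIntegers ℚ)).HasSplitMultiplicativeReduction
      (vp.adicCompletionIntegers ℚ) := hsQ
  obtain ⟨C₁, hC₁⟩ : ∃ C : VariableChange (vp.adicCompletion ℚ),
      X.minimal (vp.adicCompletionIntegers ℚ) = C • X := ⟨_, rfl⟩
  obtain ⟨C₂, hC₂⟩ : ∃ C : VariableChange (v.adicCompletion K),
      (X.map (φ : vp.adicCompletion ℚ →+* v.adicCompletion K)).minimal (v.adicCompletionIntegers K) =
        C • X.map (φ : vp.adicCompletion ℚ →+* v.adicCompletion K) := ⟨_, rfl⟩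
  haveI hmin₁ : ((X.minimal (vp.adicCompletionIntegers ℚ)).map
      (φ : vp.adicCompletion ℚ →+* v.adicCompletion K)).IsMinimal (v.adicCompletionIntegers K) :=
    (isMinimal_map_iff φ hrange _).mpr inferInstance
  haveI : (X.minimal (vp.adicCompletionIntegers ℚ)).IsElliptic := by rw [hC₁]; infer_instance
  have hΔ : ((X.minimal (vp.adicCompletionIntegers ℚ)).map
      (φ : vp.adicCompletion ℚ →+* v.adicCompletion K)).Δ ≠ 0 :=
    ((X.minimal (vp.adicCompletionIntegers ℚ)).map
      (φ : vp.adicCompletion ℚ →+* v.adicCompletion K)).isUnit_Δ.ne_zero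
  have hrel : (X.map (φ : vp.adicCompletion ℚ →+* v.adicCompletion K)).minimal (v.adicCompletionIntegers K) =
      (C₂ * (C₁.map (φ : vp.adicCompletion ℚ →+* v.adicCompletion K))⁻¹) •
        (X.minimal (vp.adicCompletionIntegers ℚ)).map (φ : vp.adicCompletion ℚ →+* v.adicCompletion K) := by
    rw [hC₂, hC₁, ← map_variableChange, mul_smul, inv_smul_smul]
  have hsK' : ((X.map (φ : vp.adicCompletion ℚ →+* v.adicCompletion K)).minimal
      (v.adicCompletionIntegers K)).HasSplitMultiplicativeReduction (v.adicCompletionIntegers K) := by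
    rw [hasSplitMultiplicativeReduction_iff_of_isMinimal_of_eq_smul (v.adicCompletionIntegers K) hrel hΔ,
      hasSplitMultiplicativeReduction_map_ringEquiv_iff ψ φ hc]
    exact hsQ'
  have hsK : (W.baseChange K).HasSplitMultiplicativeReductionAt v := by
    change (((W.baseChange K).baseChange (v.adicCompletion K)).minimal
      (v.adicCompletionIntegers K)).HasSplitMultiplicativeReduction (v.adicCompletionIntegers K)
    rw [← hX]
    exact hsK'
  -- (a) and the Tamagawa numbers, from the carrier-row data at the split place
  obtain ⟨σ, hσ⟩ := HeightOneSpectrum.exists_algEquiv_smul_eq (F := ℚ) (w := v) (w' := w)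
    (LocalField.heightOneSpectrum_rat_eq_of_natCast_mem q _ _ (LocalField.natCast_mem_under q v hqv)
      (LocalField.natCast_mem_under q w hqw))
  have hσv : σ • v ≠ v := by rw [hσ]; exact hwv
  obtain ⟨hminK, -, hcK, -, -⟩ := carrierRowData_of_split W K q hK σ v hσv hqv
  refine ⟨hminK, hsK, ?_⟩
  -- (c) `ord_v Δ_min(W ⊗ K) = c_v(W ⊗ K) = c_q(W/ℚ_q) = ord_q Δ_min(W)`
  obtain ⟨vZ, hvZ⟩ : ∃ u : HeightOneSpectrum ℤ, (primesEquiv u : ℕ) = q :=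
    ⟨primesEquiv.symm ⟨q, hq⟩, by rw [Equiv.apply_symm_apply]⟩
  rw [← localTamagawaNumber_eq_ordMinimalDiscriminant_of_hasSplitMultiplicativeReductionAt v (W.baseChange K) hsK,
    hcK]
  exact localTamagawaNumber_eq_padicValInt_of_split W vZ hvZ hs

end Summit.BirchSwinnertonDyer.BirchSwinnertonDyer.Theorems.TateComponent

end
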